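import Summits.ValiantsHypothesis.ValiantsHypothesis.Theorems.NewtonUnitEquationsTwoProductsPlanarCellBlockMerge

/-!
# Micro-rung `lagrange-codepth` (FULL DEPTH) — DEFINITIONS (statement texts = val-idea-36 g2)

PROVENANCE: the declarations below are lines 23–57 of `pub/ideators/val-idea-36/Sketch-g2.lean` (sha16 720993a40f1032b5; val-idea-36 g2,
crux-ideate lens strengthen-to-induct on stmt-ValiantsHypothesis-5906, card `Cruxes/TwoProducts/Ideas/lagrange-codepth.md` @f6756d409969;
critic of record val-idea-crit-8 g2, VERDICT #9: PASS as MICRO-RUNG for L1/L2 only — `CoDepthLaw` (S⁺) KILLED and NOT filed here),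
filed VERBATIM by val-lit-p3 g17 (merged-desk RULING #333 (d)); the only changes are the namespace (`…TwoProducts.FullDepth`) and this
header.  Objects: the elementary symmetric polynomials of the tails `esymmTail`, the root polynomial `rootPoly`, the co-depth `coDepth`,
`FullDepth` (all layers `e_k`, `0 < k < m`, agree), and the statements `FullDepthFactorisation` (L1: `tailDiff u v = ∏_j (u_j − v_i)`)
and `FullDepthCellLaw` (L2: at full depth every cell family has at most one point, ANY alphabet).  Proofs: `…FullDepthFactorisation`,
`…FullDepthCellLaw`.  Vocabulary: `…FormalLogLinearisation` (`Expo`, `tailDiff`), `…PlanarCell` (`IsCellFamily`).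
HONEST LABEL: a micro-rung (the co-depth-0 slice of the per-cell law); nothing here closes 5906 (`TwoProducts` / `ResidualLawV23` /
`PlanarCellBound` remain OPEN); VP ≠ VNP is NOT proved.  No instances, no notation, no named facts.
-/

noncomputable section

-- Sub = Summit single-conjunct layout: the duplicated namespace component is mandated by the tree.
set_option linter.dupNamespace false

open scoped BigOperators
open MvPolynomial
open Summit.ValiantsHypothesis.ValiantsHypothesis.Theorems.NewtonUnitEquations.TwoProducts.FormalLogLinearisation
open Summit.ValiantsHypothesis.ValiantsHypothesis.Theorems.NewtonUnitEquations.TwoProducts.PlanarCell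

namespace Summit.ValiantsHypothesis.ValiantsHypothesis.Theorems.NewtonUnitEquations.TwoProducts.FullDepth

variable {m : ℕ}

/-- The `k`-th elementary symmetric polynomial OF THE TAILS, an element of `ℂ[X,Y]`:
`e_k(u) = Σ_{|J| = k} ∏_{j ∈ J} u_j`, so that `∏_j (1 + u_j) = Σ_k e_k(u)` and
`tailDiff u v = Σ_{k ≥ 1} (e_k(u) − e_k(v))` (Newton–Girard layer decomposition). -/
noncomputable def esymmTail (k : ℕ) (u : Fin m → MvPolynomial (Fin 2) ℂ) : MvPolynomial (Fin 2) ℂ :=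
  ∑ J ∈ (Finset.univ : Finset (Fin m)).powersetCard k, ∏ j ∈ J, u j

/-- The ROOT POLYNOMIAL `R_u(Z) = ∏_j (Z − u_j) ∈ ℂ[X,Y][Z]` whose root multiset is the family of tails. -/
noncomputable def rootPoly (u : Fin m → MvPolynomial (Fin 2) ℂ) : Polynomial (MvPolynomial (Fin 2) ℂ) :=
  ∏ j, (Polynomial.X - Polynomial.C (u j))

/-- The CO-DEPTH `c(u,v) = deg_Z (R_u − R_v) = m − d₀`, where `d₀ = min {k ≥ 1 : e_k(u) ≠ e_k(v)}` is the DEPTH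
(the first elementary-symmetric layer of `tailDiff` that does not vanish identically).  `c = 0` iff
`e_k(u) = e_k(v)` for all `k < m` ("full depth"); `c ≤ m − 1` whenever `1 ≤ m`. -/
noncomputable def coDepth (u v : Fin m → MvPolynomial (Fin 2) ℂ) : ℕ :=
  (rootPoly u - rootPoly v).natDegree

/-- FULL DEPTH: all elementary symmetric layers below the last agree identically in `ℂ[X,Y]`. -/
def FullDepth (u v : Fin m → MvPolynomial (Fin 2) ℂ) : Prop :=
  ∀ k, 0 < k → k < m → esymmTail k u = esymmTail k v

/-- **L1 (Vieta factorisation at full depth — provable now, ~S).**  If `e_k(u) = e_k(v)` for `0 < k < m` then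
`R_u − R_v` is the constant `(−1)^m (e_m(u) − e_m(v)) = (−1)^m · tailDiff u v`; evaluating at the root `Z = v_i`
of `R_v` gives `tailDiff u v = ∏_j (u_j − v_i)` for EVERY `i` — the difference of the two products is itself ONE
product of `m` polynomials, each supported on `≤ 2t` tail letters. -/
def FullDepthFactorisation : Prop :=
  ∀ (m : ℕ) (u v : Fin m → MvPolynomial (Fin 2) ℂ), FullDepth u v →
    ∀ i : Fin m, tailDiff u v = ∏ j, (u j - v i)

/-- **L2 (full-depth cell law — provable now from L1, ~M).**  At full depth every planar cell carries AT MOST ONE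
visible point: in a strict cell each factor `u_j − v_i` has a constant top letter, so the product has the constant
top `Σ_j top(u_j − v_i)`; tie cells have `≤ 1` point anyway (all witnesses proportional).  No hypothesis on the
alphabet: relations, towers, shared letters are all allowed. -/
def FullDepthCellLaw : Prop :=
  ∀ (m : ℕ) (u v : Fin m → MvPolynomial (Fin 2) ℂ), (∀ j, coeff 0 (u j) = 0) → (∀ j, coeff 0 (v j) = 0) →
    FullDepth u v → ∀ (R : Expo → Expo → Prop) (S : Finset Expo), IsCellFamily u v R S → S.card ≤ 1

end Summit.ValiantsHypothesis.ValiantsHypothesis.Theorems.NewtonUnitEquations.TwoProducts.FullDepth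

end
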